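import Summits.CriticalPhenomena.Ising3DConformalLimit.Theorems.PerfectScreeningMoebiusLimitExistsMackConverse
import Literature.Probability.LatticeModels.InversionPositivity
import HarnessLib

/-!
# Levelwise Mack converse: radial OS positivity from inversion covariance AT THE LEVELS USED
(line lead c6 of crux stmt-CriticalPhenomena-4671 `InversionPositiveLimit`; `--supports stmt-CriticalPhenomena-4671`;
model independent, any dimension `d`)

The pointwise Mack converse of the tree (`PerfectScreeningMoebiusLimitExistsMackConverse.lean`,
`isInversionPositive_of_covariant_of_reflectionPositive`: translation invariance + scale covariance + inversion
covariance + permutation symmetry + reflection invariance and positivity along one axis ⇒ `IsInversionPositive`)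
consumes inversion covariance of `S` at ALL levels.  Its proof, however, touches `S` only at the levels
`k a + k b` of the Gram matrix at hand.  This file records the levelwise statements:

* `corr_cayley_at` — covariance of `S_n` under the Cayley map `J = T_p ∘ D_2 ∘ ι ∘ T_{-p}` from inversion
  covariance AT LEVEL `n`;
* `inversionGram_eq_weight_mul_osPointKernel_at` — the entry `(a, b)` of the radial OS Gram matrix factorises
  through the planar OS kernel using inversion covariance at level `k a + k b` only;
* `posSemidef_inversionGram_of_covariantAt` (registered anchor, `∀`-form) — the radial OS Gram matrix over an
  admissible family of arities `k` is positive semidefinite as soon as `S` is inversion covariant at the levels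
  `k a + k b` (plus the planar OS premises).

Used by `PositivityBegetsConformalityInversionPositiveLimitLevelFour.lean` (item stmt-4672 ⟺ level-4 inversion
covariance).  No `sorry`, no definitions.
-/

noncomputable section

open EuclideanGeometry Filter Topology Finset
open Literature.Probability.LatticeModels Literature.MathematicalPhysics.QuantumFieldTheory

namespace Summit.CriticalPhenomena.Ising3DConformalLimit.InversionPositiveLimitLevelwiseMack

open Summit.CriticalPhenomena.Ising3DConformalLimit.MoebiusLimitExistsMackConverse

variable {d : ℕ}

/-- **Covariance under the Cayley map at one level.** If `S` is translation invariant and scale covariant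
with weight `Δ`, and inversion covariant with weight `Δ` AT LEVEL `n`, then for a level-`n` configuration
avoiding the pole `p = -e_τ`, `S_n(J v) = 2^{-nΔ} (∏ᵢ ‖vᵢ - p‖^{2Δ}) S_n(v)` for the Cayley map
`J = T_p ∘ D_2 ∘ ι ∘ T_{-p}` (the proof of `corr_cayley`, which uses inversion covariance at level `n` only).
[cite: FrancescoMathieuSenechal1997, §4.3.1 eq. (4.62)] -/
theorem corr_cayley_at {Δ : ℝ} {S : CorrFamily d} (τ : Fin d) (htr : IsTranslationInvariant S)
    (hsc : IsScaleCovariant Δ S) {n : ℕ}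
    (hinvn : ∀ x : Fin n → EuclideanSpace ℝ (Fin d), (∀ i, x i ≠ 0) →
      S n (fun i => inversion 0 1 (x i)) = (∏ i, ‖x i‖ ^ (2 * Δ)) * S n x)
    (v : Fin n → EuclideanSpace ℝ (Fin d)) (hv : ∀ i, v i ≠ (-(EuclideanSpace.single τ (1 : ℝ)))) :
    S n (fun i => inversion (-(EuclideanSpace.single τ (1 : ℝ))) (Real.sqrt 2) (v i)) =
      (2 : ℝ) ^ (-(n : ℝ) * Δ) * (∏ i, ‖v i - (-(EuclideanSpace.single τ (1 : ℝ)))‖ ^ (2 * Δ)) * S n v := by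
  have e1 : (fun i => inversion (-(EuclideanSpace.single τ (1 : ℝ))) (Real.sqrt 2) (v i)) =
      fun i => (2 : ℝ) • inversion (0 : EuclideanSpace ℝ (Fin d)) 1 (v i - (-(EuclideanSpace.single τ (1 : ℝ)))) +
        (-(EuclideanSpace.single τ (1 : ℝ))) :=
    funext fun i => cayley_eq_generators τ (v i)
  have h1 := htr n (-(EuclideanSpace.single τ (1 : ℝ)))
    (fun i => (2 : ℝ) • inversion (0 : EuclideanSpace ℝ (Fin d)) 1 (v i - (-(EuclideanSpace.single τ (1 : ℝ)))))
  have h2 := hsc n 2 two_pos (fun i => inversion (0 : EuclideanSpace ℝ (Fin d)) 1 (v i - (-(EuclideanSpace.single τ (1 : ℝ)))))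
  have h3 := hinvn (fun i => v i - (-(EuclideanSpace.single τ (1 : ℝ)))) (fun i => sub_ne_zero.2 (hv i))
  have h4 := htr n (-(-(EuclideanSpace.single τ (1 : ℝ)))) v
  simp only [← sub_eq_add_neg] at h4
  rw [e1, h1, h2, h3, h4]
  ring

/-- **Levelwise factorisation of the radial OS Gram matrix through the planar OS kernel**: the entry
`(a, b)` only needs inversion covariance of `S` at level `k a + k b` (cf.
`inversionGram_eq_weight_mul_osPointKernel`). [folklore] -/
theorem inversionGram_eq_weight_mul_osPointKernel_at {Δ : ℝ} {S : CorrFamily d} (τ : Fin d)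
    (htr : IsTranslationInvariant S) (hsc : IsScaleCovariant Δ S) (hperm : IsPermutationSymmetric S)
    {m : ℕ} {k : Fin m → ℕ} {X : (a : Fin m) → Fin (k a) → EuclideanSpace ℝ (Fin d)}
    (hX : ∀ a i, X a i ≠ 0 ∧ ‖X a i‖ < 1) (a b : Fin m)
    (hinv : ∀ x : Fin (k a + k b) → EuclideanSpace ℝ (Fin d), (∀ i, x i ≠ 0) →
      S (k a + k b) (fun i => inversion 0 1 (x i)) = (∏ i, ‖x i‖ ^ (2 * Δ)) * S (k a + k b) x) :
    (∏ i, ‖X b i‖ ^ (-(2 * Δ))) *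
        S (k a + k b) (Fin.append (X a) (fun i => inversion 0 1 (X b i))) =
      ((2 : ℝ) ^ (-(k a : ℝ) * Δ) * ∏ i, ‖inversion (-(EuclideanSpace.single τ (1 : ℝ))) (Real.sqrt 2) (X a i) - (-(EuclideanSpace.single τ (1 : ℝ)))‖ ^ (2 * Δ)) *
        ((2 : ℝ) ^ (-(k b : ℝ) * Δ) * ∏ i, ‖inversion (-(EuclideanSpace.single τ (1 : ℝ))) (Real.sqrt 2) (X b i) - (-(EuclideanSpace.single τ (1 : ℝ)))‖ ^ (2 * Δ)) *
        S (k b + k a) (Fin.append (fun i => axisReflection τ (inversion (-(EuclideanSpace.single τ (1 : ℝ))) (Real.sqrt 2) (X b i))) (fun i => inversion (-(EuclideanSpace.single τ (1 : ℝ))) (Real.sqrt 2) (X a i))) := by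
  set v : Fin (k a + k b) → EuclideanSpace ℝ (Fin d) :=
    Fin.append (fun i => inversion (-(EuclideanSpace.single τ (1 : ℝ))) (Real.sqrt 2) (X a i)) (fun i => axisReflection τ (inversion (-(EuclideanSpace.single τ (1 : ℝ))) (Real.sqrt 2) (X b i))) with hv
  have hxp : ∀ c i, X c i ≠ (-(EuclideanSpace.single τ (1 : ℝ))) := fun c i => ne_pole_of_norm_lt_one τ (hX c i).2
  have hJv : (fun i => inversion (-(EuclideanSpace.single τ (1 : ℝ))) (Real.sqrt 2) (v i)) = Fin.append (X a) (fun i => inversion 0 1 (X b i)) := by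
    funext i
    refine Fin.addCases (fun j => ?_) (fun j => ?_) i
    · simp [hv]
    · simp only [hv, Fin.append_right]
      rw [← cayley_unitInversion τ (hX b j).1 (hxp b j), cayley_cayley]
  have hvp : ∀ i, v i ≠ (-(EuclideanSpace.single τ (1 : ℝ))) := by
    intro i
    refine Fin.addCases (fun j => ?_) (fun j => ?_) i
    · simp only [hv, Fin.append_left]
      exact cayley_ne_pole τ (hxp a j)
    · simp only [hv, Fin.append_right]
      rw [← cayley_unitInversion τ (hX b j).1 (hxp b j)]
      exact cayley_ne_pole τ (ne_pole_of_one_lt_norm τ (one_lt_norm_inversion (hX b j).1 (hX b j).2))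
  rw [← hJv, corr_cayley_at τ htr hsc hinv v hvp]
  have hK : S (k a + k b) v =
      S (k b + k a) (Fin.append (fun i => axisReflection τ (inversion (-(EuclideanSpace.single τ (1 : ℝ))) (Real.sqrt 2) (X b i))) (fun i => inversion (-(EuclideanSpace.single τ (1 : ℝ))) (Real.sqrt 2) (X a i))) := by
    rw [← hperm.comp_equiv (finBlockSwap (k b) (k a)), fin_append_comp_finBlockSwap]
  have hprod : (∏ i, ‖v i - (-(EuclideanSpace.single τ (1 : ℝ)))‖ ^ (2 * Δ)) =
      (∏ i, ‖inversion (-(EuclideanSpace.single τ (1 : ℝ))) (Real.sqrt 2) (X a i) - (-(EuclideanSpace.single τ (1 : ℝ)))‖ ^ (2 * Δ)) *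
        ∏ i, ‖axisReflection τ (inversion (-(EuclideanSpace.single τ (1 : ℝ))) (Real.sqrt 2) (X b i)) - (-(EuclideanSpace.single τ (1 : ℝ)))‖ ^ (2 * Δ) := by
    rw [Fin.prod_univ_add]
    simp [hv]
  have hwb : (∏ i, ‖X b i‖ ^ (-(2 * Δ))) * ∏ i, ‖axisReflection τ (inversion (-(EuclideanSpace.single τ (1 : ℝ))) (Real.sqrt 2) (X b i)) - (-(EuclideanSpace.single τ (1 : ℝ)))‖ ^ (2 * Δ) =
      ∏ i, ‖inversion (-(EuclideanSpace.single τ (1 : ℝ))) (Real.sqrt 2) (X b i) - (-(EuclideanSpace.single τ (1 : ℝ)))‖ ^ (2 * Δ) := by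
    rw [← Finset.prod_mul_distrib]
    exact Finset.prod_congr rfl fun i _ => weight_identity τ Δ (hX b i).1 (hX b i).2
  have h2 : (2 : ℝ) ^ (-((k a + k b : ℕ) : ℝ) * Δ) =
      (2 : ℝ) ^ (-(k a : ℝ) * Δ) * (2 : ℝ) ^ (-(k b : ℝ) * Δ) := by
    rw [← Real.rpow_add two_pos]; push_cast; ring_nf
  rw [hK, hprod, h2, ← hwb]
  ring

/-- **Levelwise Mack converse.** Let `S : CorrFamily d` be translation invariant, scale covariant with weight
`Δ`, permutation symmetric, and reflection invariant and reflection positive along the axis `τ`.  If `S` is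
inversion covariant with weight `Δ` at every level `k a + k b` occurring in the radial OS Gram matrix of an
admissible family `X` (injective configurations of arities `k` in the punctured open unit ball), then that
Gram matrix `M_{ab} = (∏ᵢ ‖X_b i‖^{-2Δ}) S(X_a ⊔ ιX_b)` is positive semidefinite — the proof of
`isInversionPositive_of_covariant_of_reflectionPositive` run at these levels only.
[cite: LuscherMack1975, §2–§3] -/
theorem posSemidef_inversionGram_of_covariantAt : ∀ {d : ℕ} (τ : Fin d) {Δ : ℝ} {S : Literature.Probability.LatticeModels.CorrFamily d}, Literature.Probability.LatticeModels.IsTranslationInvariant S → Literature.Probability.LatticeModels.IsScaleCovariant Δ S → Literature.MathematicalPhysics.QuantumFieldTheory.IsPermutationSymmetric S → Literature.MathematicalPhysics.QuantumFieldTheory.IsReflectionInvariantAlong τ S → Literature.MathematicalPhysics.QuantumFieldTheory.IsReflectionPositiveAlong τ S → ∀ {m : ℕ} {k : Fin m → ℕ} {X : (a : Fin m) → Fin (k a) → EuclideanSpace ℝ (Fin d)}, (∀ a i, X a i ≠ 0 ∧ ‖X a i‖ < 1) → (∀ a, Function.Injective (X a)) → (∀ a b : Fin m, ∀ x : Fin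 (k a + k b) → EuclideanSpace ℝ (Fin d), (∀ i, x i ≠ 0) → S (k a + k b) (fun i => EuclideanGeometry.inversion 0 1 (x i)) = (∏ i, ‖x i‖ ^ (2 * Δ)) * S (k a + k b) x) → (Matrix.of fun a b : Fin m => (∏ i, ‖X b i‖ ^ (-(2 * Δ))) * S (k a + k b) (Fin.append (X a) (fun i => EuclideanGeometry.inversion 0 1 (X b i)))).PosSemidef := by
  intro d τ Δ S htr hsc hperm hR hrp m k X hX hinj hinv
  let cfg : Fin m → HalfSpaceConfig d τ := fun c =>
    { n := k c
      pts := fun i => inversion (-(EuclideanSpace.single τ (1 : ℝ))) (Real.sqrt 2) (X c i)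
      injective := (cayley_injective τ).comp (hinj c)
      pos := fun i => cayley_apply_self_pos τ (hX c i).2 }
  have hfac : ∀ a b : Fin m, (∏ i, ‖X b i‖ ^ (-(2 * Δ))) *
        S (k a + k b) (Fin.append (X a) (fun i => inversion 0 1 (X b i))) =
      ((2 : ℝ) ^ (-(k a : ℝ) * Δ) * ∏ i, ‖inversion (-(EuclideanSpace.single τ (1 : ℝ))) (Real.sqrt 2) (X a i) - (-(EuclideanSpace.single τ (1 : ℝ)))‖ ^ (2 * Δ)) *
        ((2 : ℝ) ^ (-(k b : ℝ) * Δ) * ∏ i, ‖inversion (-(EuclideanSpace.single τ (1 : ℝ))) (Real.sqrt 2) (X b i) - (-(EuclideanSpace.single τ (1 : ℝ)))‖ ^ (2 * Δ)) *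
        osPointKernel S (cfg b) (cfg a) :=
    fun a b => inversionGram_eq_weight_mul_osPointKernel_at τ htr hsc hperm hX a b (hinv a b)
  refine Matrix.PosSemidef.of_dotProduct_mulVec_nonneg ?_ fun c => ?_
  · refine Matrix.IsHermitian.ext fun a b => ?_
    rw [star_trivial, Matrix.of_apply, Matrix.of_apply, hfac, hfac, osPointKernel_comm hR hperm]
    ring
  · have h0 := hrp m cfg
      (fun a => c a * ((2 : ℝ) ^ (-(k a : ℝ) * Δ) * ∏ i, ‖inversion (-(EuclideanSpace.single τ (1 : ℝ))) (Real.sqrt 2) (X a i) - (-(EuclideanSpace.single τ (1 : ℝ)))‖ ^ (2 * Δ)))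
    simp only [dotProduct, Matrix.mulVec, star_trivial, Matrix.of_apply, Finset.mul_sum]
    rw [Finset.sum_comm]
    refine h0.trans_eq (Finset.sum_congr rfl fun b _ => Finset.sum_congr rfl fun a _ => ?_)
    rw [hfac]
    ring


end Summit.CriticalPhenomena.Ising3DConformalLimit.InversionPositiveLimitLevelwiseMack

end
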